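import Mathlib

/-!
# A1TensorSplitting — `ℂ ⊗[ℚ] F ≃ₐ[ℂ] ((F →ₐ[ℚ] ℂ) → ℂ)` for a number field `F`

route/T4-A1-p7.md (A0.4) uses the decomposition `F ⊗_ℚ ℂ ≅ ∏_{σ : F ↪ ℂ} ℂ` of the CM field tensored up
to `ℂ` (it is what splits `H¹(A, ℂ)` into the eigenlines `ℓ_σ`); LEAN-ANNEX-p7.md §4 listed it as «not
formalised (Mathlib holds no ready-made `F ⊗[ℚ] ℂ ≃ₐ[ℂ] (F →ₐ[ℚ] ℂ) → ℂ`)».  This file supplies it for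
every finite-dimensional field extension `F/ℚ` (in particular every number field), by the standard
argument: the evaluation map `c ⊗ x ↦ (σ ↦ c · σ x)` is a `ℂ`-algebra map; it is surjective because a
non-zero linear functional vanishing on its image would be a vanishing linear combination of the
embeddings, contradicting Dedekind's independence of characters (`linearIndependent_monoidHom`); and
the two sides have the same `ℂ`-dimension `[F : ℚ]` (`Module.finrank_baseChange`, `AlgHom.card`), so it
is bijective.

* `ev F : ℂ ⊗[ℚ] F →ₐ[ℂ] ((F →ₐ[ℚ] ℂ) → ℂ)` — the evaluation map, `ev_tmul`.
* `ev_surjective`, `ev_bijective`, and the algebra isomorphism `tensorEquiv F`.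
* `finrank_eq_card_embeddings` — `[F : ℚ] = #(F →ₐ[ℚ] ℂ)` as used in (A0.4).

Nothing about abelian varieties, cohomology or CM types is asserted; the geometric statement
`H¹(A, ℂ) = ⊕_σ ℓ_σ` is the prose's application of this isomorphism to the `F`-module `H¹(A, ℚ) ⊗ ℂ`.
-/

namespace Summit.Ventures.HodgeRepro2.A1TensorSplitting

open TensorProduct Module

variable (F : Type*) [Field F] [Algebra ℚ F]

/-- The `ℚ`-algebra map `F → ((F →ₐ[ℚ] ℂ) → ℂ)`, `x ↦ (σ ↦ σ x)`. -/
noncomputable def evQ : F →ₐ[ℚ] ((F →ₐ[ℚ] ℂ) → ℂ) :=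
  AlgHom.pi fun σ => σ

/-- Value of `evQ`. -/
@[simp] theorem evQ_apply (x : F) (σ : F →ₐ[ℚ] ℂ) : evQ F x σ = σ x := rfl

/-- The evaluation map `ℂ ⊗[ℚ] F → ((F →ₐ[ℚ] ℂ) → ℂ)`, `c ⊗ x ↦ (σ ↦ c · σ x)`, as a `ℂ`-algebra map
(the base change of `evQ`). -/
noncomputable def ev : ℂ ⊗[ℚ] F →ₐ[ℂ] ((F →ₐ[ℚ] ℂ) → ℂ) :=
  AlgHom.liftEquiv ℚ ℂ F ((F →ₐ[ℚ] ℂ) → ℂ) (evQ F)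

/-- Value of `ev` on a pure tensor. -/
theorem ev_tmul (c : ℂ) (x : F) (σ : F →ₐ[ℚ] ℂ) : ev F (c ⊗ₜ x) σ = c * σ x := by
  simp [ev, AlgHom.liftEquiv_tmul, evQ]

/-- `ev` on `1 ⊗ x` is the tuple of the embeddings evaluated at `x`. -/
theorem ev_one_tmul (x : F) : ev F (1 ⊗ₜ x) = fun σ => σ x := by
  funext σ
  rw [ev_tmul, one_mul]

/-- The embeddings `F →ₐ[ℚ] ℂ`, viewed as functions `F → ℂ`, are linearly independent over `ℂ`
(Dedekind's independence of characters, restricted from monoid homomorphisms). -/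
theorem linearIndependent_algHom :
    LinearIndependent ℂ (fun σ : F →ₐ[ℚ] ℂ => (σ : F → ℂ)) := by
  have hinj : Function.Injective (fun σ : F →ₐ[ℚ] ℂ => (σ : F →* ℂ)) := by
    intro σ τ h
    ext x
    have := congrArg (fun f : F →* ℂ => f x) h
    simpa using this
  exact (linearIndependent_monoidHom F ℂ).comp _ hinj

variable [FiniteDimensional ℚ F]

/-- `ev` is surjective: a linear functional vanishing on its image is a vanishing linear combination
of the embeddings, hence zero. -/
theorem ev_surjective : Function.Surjective (ev F) := by
  classical
  by_contra hns
  have hlt : LinearMap.range (ev F).toLinearMap < ⊤ := by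
    rw [lt_top_iff_ne_top]
    intro htop
    exact hns (LinearMap.range_eq_top.1 htop)
  obtain ⟨φ, hφ, hle⟩ := Submodule.exists_le_ker_of_lt_top _ hlt
  -- the coefficients of φ
  set d : (F →ₐ[ℚ] ℂ) → ℂ := fun σ => φ (fun τ => if σ = τ then 1 else 0) with hd
  have hvan : ∀ x : F, ∑ σ : F →ₐ[ℚ] ℂ, σ x * d σ = 0 := by
    intro x
    have hmem : (fun σ : F →ₐ[ℚ] ℂ => σ x) ∈ LinearMap.range (ev F).toLinearMap :=
      ⟨1 ⊗ₜ x, ev_one_tmul F x⟩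
    have h0 : φ (fun σ : F →ₐ[ℚ] ℂ => σ x) = 0 := LinearMap.mem_ker.1 (hle hmem)
    rw [LinearMap.pi_apply_eq_sum_univ φ (fun σ : F →ₐ[ℚ] ℂ => σ x)] at h0
    simpa [hd, smul_eq_mul] using h0
  have hcomb : ∑ σ : F →ₐ[ℚ] ℂ, d σ • (σ : F → ℂ) = 0 := by
    funext x
    simp only [Finset.sum_apply, Pi.smul_apply, smul_eq_mul, Pi.zero_apply]
    rw [← hvan x]
    exact Finset.sum_congr rfl fun σ _ => mul_comm _ _
  have hd0 : ∀ σ, d σ = 0 :=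
    Fintype.linearIndependent_iff.1 (linearIndependent_algHom F) d hcomb
  apply hφ
  refine LinearMap.ext fun f => ?_
  rw [LinearMap.pi_apply_eq_sum_univ φ f, LinearMap.zero_apply]
  refine Finset.sum_eq_zero fun σ _ => ?_
  have : φ (fun j => if σ = j then (1 : ℂ) else 0) = d σ := rfl
  rw [this, hd0 σ, smul_zero]

/-- `[F : ℚ] = #(F →ₐ[ℚ] ℂ)`: the number of complex embeddings of `F` is its degree
(`AlgHom.card`, `ℂ` algebraically closed, `F/ℚ` separable in characteristic zero). -/
theorem finrank_eq_card_embeddings : finrank ℚ F = Fintype.card (F →ₐ[ℚ] ℂ) :=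
  (AlgHom.card ℚ F ℂ).symm

/-- The two sides of `ev` have the same `ℂ`-dimension, namely `[F : ℚ]`. -/
theorem finrank_tensor_eq : finrank ℂ (ℂ ⊗[ℚ] F) = finrank ℂ ((F →ₐ[ℚ] ℂ) → ℂ) := by
  rw [Module.finrank_baseChange, Module.finrank_fintype_fun_eq_card, finrank_eq_card_embeddings]

/-- `ev` is bijective (surjective between `ℂ`-spaces of the same finite dimension). -/
theorem ev_bijective : Function.Bijective (ev F) := by
  refine ⟨?_, ev_surjective F⟩
  exact (LinearMap.injective_iff_surjective_of_finrank_eq_finrank (finrank_tensor_eq F)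
    (f := (ev F).toLinearMap)).2 (ev_surjective F)

/-- (A0.4): `ℂ ⊗[ℚ] F ≃ₐ[ℂ] ((F →ₐ[ℚ] ℂ) → ℂ)`, `c ⊗ x ↦ (σ ↦ c · σ x)`. -/
noncomputable def tensorEquiv : (ℂ ⊗[ℚ] F) ≃ₐ[ℂ] ((F →ₐ[ℚ] ℂ) → ℂ) :=
  AlgEquiv.ofBijective (ev F) (ev_bijective F)

/-- Value of `tensorEquiv` on a pure tensor. -/
theorem tensorEquiv_tmul (c : ℂ) (x : F) (σ : F →ₐ[ℚ] ℂ) :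
    tensorEquiv F (c ⊗ₜ x) σ = c * σ x :=
  ev_tmul F c x σ

end Summit.Ventures.HodgeRepro2.A1TensorSplitting
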